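import Mathlib
import Summits.ValiantsHypothesis.ValiantsHypothesis.Theorems.KPlusLogSqLawStepTerminalMirror

/-!
# The MIRROR CONTINUATION LAW `C′` (static path model behind `KPlusLogSqLaw.TropicalB`)

Cell pub-symmetroid, seat conjb-2 (g22). A helper toward the crux `TropicalB`
(`Summit.ValiantsHypothesis.ValiantsHypothesis.Theses.KPlusLogSqLaw.TropicalB`, item
`stmt-ValiantsHypothesis-19771`); it earns no crux credit and is not evidence for `MatrixDescartes` or for
Valiant's hypothesis.

Setting (as in `KPlusLogSqLawStepTerminal`): lines `S_t(θ) = b t + s t * θ`, even lines the upper class, odd lines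
the lower class; the window `[u, v]` is separated at `θ` iff every even line of `[u, v]` is strictly above every odd
line of `[u, v]` at `θ`; a row `j` of odd reach `d` STEPS iff the separation sets of `[j, j+d]` and `[j+1, j+d+1]`
are non-empty and disjoint, and the step MOVES RIGHT (LEFT) iff the second set lies to the right (left) of the first.

`KPlusLogSqLawStepTerminal{,Mirror}` prove the CONTINUATION LAW `C` (THEORY-NOTE-g21 §3.1ter): if rows `i` and
`i+1` both step then `(s (i+1) - s i) * (s (i+d+1) - s i) > 0` in direction form, i.e. the step at row `i` moves
toward the natural side of row `i`. This file proves its INDEX-REVERSAL MIRROR `C′` (THEORY-NOTE-g21 §3.1quater,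
THEORY-NOTE-g22 §1): if rows `a-1` and `a` both step then `(s (a+d+1) - s (a+d)) * (s (a+d+1) - s a) > 0`, again in
direction form — the four theorems `preceded_step_{even,odd}_{left,right}` say: given the sign of
`s (a+d+1) - s (a+d)` and the direction of the step at row `a` that `C′` forbids, row `a-1` does NOT step (the
separation sets of `[a-1, a+d-1]` and `[a, a+d]` meet).

PROOF. Reverse the indices, `t ↦ a + d + 1 - t`: the windows `[a+1, a+d+1]`, `[a, a+d]`, `[a-1, a+d-1]` of row `a`
and row `a-1` become the windows `[0, d]`, `[1, d+1]`, `[2, d+2]` of rows `0` and `1` of the reversed lines, a step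
keeps its separation sets (so its direction is reversed in row order but not in `θ`), and the far pair
`(a+d, a+d+1)` becomes the near pair `(1, 0)`. For `a` even (`a + d + 1` even) the reversal preserves the parity
classes (`sep_of_rev`, `rev_of_sep`); for `a` odd it swaps them, which is undone by negating all lines
(`sep_of_negrev`, `negrev_of_sep`). Then `away_step_terminal_even` / `away_step_terminal_even_mirror` at row `0` of
the transformed lines is exactly the claim. Combined with `C` at row `a+d` the law gives the PERIOD-`d` ANTISYMMETRY
of directions inside a run of steps and hence the PLATEAU LENGTH LAW `k ≤ d + 2` (THEORY-NOTE-g22 §1; the window-level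
four-step law is not yet in the kernel).
-/

set_option linter.dupNamespace false

namespace Summit.ValiantsHypothesis.ValiantsHypothesis.Theorems.KPlusLogSqLawStepPreceded

open Summit.ValiantsHypothesis.ValiantsHypothesis.Theorems.KPlusLogSqLawStepTerminal (away_step_terminal_even)
open Summit.ValiantsHypothesis.ValiantsHypothesis.Theorems.KPlusLogSqLawStepTerminalMirror
  (away_step_terminal_even_mirror)

/-- Index reversal `t ↦ M - t` with `M` even (parity classes preserved): separation of the window `[lo, hi]` of the
original lines from separation of the window `[M - hi, M - lo]` of the reversed lines. -/
theorem sep_of_rev (s b : ℕ → ℝ) (M lo hi : ℕ) (hM : Even M) (hlh : lo ≤ hi) (hhi : hi ≤ M) (θ : ℝ)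
    (h : ∀ e o : ℕ, M - hi ≤ e → e ≤ M - lo → M - hi ≤ o → o ≤ M - lo → Even e → Odd o →
      b (M - o) + s (M - o) * θ < b (M - e) + s (M - e) * θ) :
    ∀ e o : ℕ, lo ≤ e → e ≤ hi → lo ≤ o → o ≤ hi → Even e → Odd o → b o + s o * θ < b e + s e * θ := by
  intro e o h1 h2 h3 h4 he ho
  obtain ⟨p, hp⟩ := hM
  obtain ⟨k, hk⟩ := he
  obtain ⟨m, hm⟩ := ho
  have he' : Even (M - e) := ⟨p - k, by omega⟩
  have ho' : Odd (M - o) := ⟨p - m - 1, by omega⟩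
  have := h (M - e) (M - o) (by omega) (by omega) (by omega) (by omega) he' ho'
  rwa [Nat.sub_sub_self (by omega : o ≤ M), Nat.sub_sub_self (by omega : e ≤ M)] at this

/-- Index reversal `t ↦ M - t` with `M` even: separation of the window `[M - hi, M - lo]` of the reversed lines from
separation of the window `[lo, hi]` of the original lines. -/
theorem rev_of_sep (s b : ℕ → ℝ) (M lo hi : ℕ) (hM : Even M) (hlh : lo ≤ hi) (hhi : hi ≤ M) (θ : ℝ)
    (h : ∀ e o : ℕ, lo ≤ e → e ≤ hi → lo ≤ o → o ≤ hi → Even e → Odd o → b o + s o * θ < b e + s e * θ) :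
    ∀ e o : ℕ, M - hi ≤ e → e ≤ M - lo → M - hi ≤ o → o ≤ M - lo → Even e → Odd o →
      b (M - o) + s (M - o) * θ < b (M - e) + s (M - e) * θ := by
  intro e o h1 h2 h3 h4 he ho
  obtain ⟨p, hp⟩ := hM
  obtain ⟨k, hk⟩ := he
  obtain ⟨m, hm⟩ := ho
  exact h (M - e) (M - o) (by omega) (by omega) (by omega) (by omega) ⟨p - k, by omega⟩ ⟨p - m - 1, by omega⟩

/-- Index reversal with negation, `S'_t = -S_{M-t}` with `M` odd (the reversal swaps the parity classes, the
negation swaps above/below, so even lines are again the upper class): separation of the window `[lo, hi]` of the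
original lines from separation of the window `[M - hi, M - lo]` of the transformed lines. -/
theorem sep_of_negrev (s b : ℕ → ℝ) (M lo hi : ℕ) (hM : Odd M) (hlh : lo ≤ hi) (hhi : hi ≤ M) (θ : ℝ)
    (h : ∀ e o : ℕ, M - hi ≤ e → e ≤ M - lo → M - hi ≤ o → o ≤ M - lo → Even e → Odd o →
      -b (M - o) + -s (M - o) * θ < -b (M - e) + -s (M - e) * θ) :
    ∀ e o : ℕ, lo ≤ e → e ≤ hi → lo ≤ o → o ≤ hi → Even e → Odd o → b o + s o * θ < b e + s e * θ := by
  intro e o h1 h2 h3 h4 he ho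
  obtain ⟨p, hp⟩ := hM
  obtain ⟨k, hk⟩ := he
  obtain ⟨m, hm⟩ := ho
  have he' : Even (M - o) := ⟨p - m, by omega⟩
  have ho' : Odd (M - e) := ⟨p - k, by omega⟩
  have := h (M - o) (M - e) (by omega) (by omega) (by omega) (by omega) he' ho'
  rw [Nat.sub_sub_self (by omega : e ≤ M), Nat.sub_sub_self (by omega : o ≤ M)] at this
  have r1 : -s e * θ = -(s e * θ) := by ring
  have r2 : -s o * θ = -(s o * θ) := by ring
  linarith

/-- Index reversal with negation, `M` odd: separation of the window `[M - hi, M - lo]` of the transformed lines from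
separation of the window `[lo, hi]` of the original lines. -/
theorem negrev_of_sep (s b : ℕ → ℝ) (M lo hi : ℕ) (hM : Odd M) (hlh : lo ≤ hi) (hhi : hi ≤ M) (θ : ℝ)
    (h : ∀ e o : ℕ, lo ≤ e → e ≤ hi → lo ≤ o → o ≤ hi → Even e → Odd o → b o + s o * θ < b e + s e * θ) :
    ∀ e o : ℕ, M - hi ≤ e → e ≤ M - lo → M - hi ≤ o → o ≤ M - lo → Even e → Odd o →
      -b (M - o) + -s (M - o) * θ < -b (M - e) + -s (M - e) * θ := by
  intro e o h1 h2 h3 h4 he ho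
  obtain ⟨p, hp⟩ := hM
  obtain ⟨k, hk⟩ := he
  obtain ⟨m, hm⟩ := ho
  have := h (M - o) (M - e) (by omega) (by omega) (by omega) (by omega) ⟨p - m, by omega⟩ ⟨p - k, by omega⟩
  have r1 : -s (M - o) * θ = -(s (M - o) * θ) := by ring
  have r2 : -s (M - e) * θ = -(s (M - e) * θ) := by ring
  linarith

/-- MIRROR CONTINUATION LAW `C′`, row `a` even, `s (a+d) < s (a+d+1)`: if the step at row `a` moves left, row
`a - 1` does not step. -/
theorem preceded_step_even_left (s b : ℕ → ℝ) (a d : ℕ) (ha : Even a) (hd : Odd d) (ha1 : 1 ≤ a)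
    (hfar : s (a + d) < s (a + d + 1))
    (hA : ∃ θ : ℝ, ∀ e o : ℕ, a ≤ e → e ≤ a + d → a ≤ o → o ≤ a + d → Even e → Odd o →
      b o + s o * θ < b e + s e * θ)
    (hB : ∃ θ : ℝ, ∀ e o : ℕ, a + 1 ≤ e → e ≤ a + d + 1 → a + 1 ≤ o → o ≤ a + d + 1 → Even e → Odd o →
      b o + s o * θ < b e + s e * θ)
    (hAB : ∀ θ : ℝ, ¬ ((∀ e o : ℕ, a ≤ e → e ≤ a + d → a ≤ o → o ≤ a + d → Even e → Odd o →
      b o + s o * θ < b e + s e * θ) ∧ (∀ e o : ℕ, a + 1 ≤ e → e ≤ a + d + 1 → a + 1 ≤ o → o ≤ a + d + 1 →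
      Even e → Odd o → b o + s o * θ < b e + s e * θ)))
    (hord : ∀ θ θ' : ℝ, (∀ e o : ℕ, a ≤ e → e ≤ a + d → a ≤ o → o ≤ a + d → Even e → Odd o →
      b o + s o * θ < b e + s e * θ) → (∀ e o : ℕ, a + 1 ≤ e → e ≤ a + d + 1 → a + 1 ≤ o → o ≤ a + d + 1 →
      Even e → Odd o → b o + s o * θ' < b e + s e * θ') → θ' < θ)
    (hP : ∃ θ : ℝ, ∀ e o : ℕ, a - 1 ≤ e → e ≤ a + d - 1 → a - 1 ≤ o → o ≤ a + d - 1 → Even e → Odd o →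
      b o + s o * θ < b e + s e * θ) :
    ∃ θ : ℝ, (∀ e o : ℕ, a - 1 ≤ e → e ≤ a + d - 1 → a - 1 ≤ o → o ≤ a + d - 1 → Even e → Odd o →
      b o + s o * θ < b e + s e * θ) ∧ (∀ e o : ℕ, a ≤ e → e ≤ a + d → a ≤ o → o ≤ a + d → Even e → Odd o →
      b o + s o * θ < b e + s e * θ) := by
  obtain ⟨θA, hθA⟩ := hA
  obtain ⟨θB, hθB⟩ := hB
  obtain ⟨θP, hθP⟩ := hP
  have hM : Even (a + d + 1) := by
    obtain ⟨k, hk⟩ := ha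
    obtain ⟨l, hl⟩ := hd
    exact ⟨k + l + 1, by omega⟩
  have hd1 : 1 ≤ d := by
    obtain ⟨l, hl⟩ := hd
    omega
  -- reversed lines `t ↦ a + d + 1 - t`; rows `a`, `a - 1` become rows `0`, `1`
  obtain ⟨θ, h1, h2⟩ := away_step_terminal_even (fun t => s (a + d + 1 - t)) (fun t => b (a + d + 1 - t)) 0 d
    (⟨0, rfl⟩ : Even 0) hd (by simpa using hfar)
    ⟨θB, fun e o g1 g2 g3 g4 he ho => rev_of_sep s b (a + d + 1) (a + 1) (a + d + 1) hM (by omega) le_rfl θB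
      hθB e o (by omega) (by omega) (by omega) (by omega) he ho⟩
    ⟨θA, fun e o g1 g2 g3 g4 he ho => rev_of_sep s b (a + d + 1) a (a + d) hM (by omega) (by omega) θA
      hθA e o (by omega) (by omega) (by omega) (by omega) he ho⟩
    (fun θ hθ => hAB θ
      ⟨sep_of_rev s b (a + d + 1) a (a + d) hM (by omega) (by omega) θ
          (fun e o g1 g2 g3 g4 he ho => hθ.2 e o (by omega) (by omega) (by omega) (by omega) he ho),
       sep_of_rev s b (a + d + 1) (a + 1) (a + d + 1) hM (by omega) le_rfl θ
          (fun e o g1 g2 g3 g4 he ho => hθ.1 e o (by omega) (by omega) (by omega) (by omega) he ho)⟩)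
    (fun θ θ' hθ hθ' => hord θ' θ
      (sep_of_rev s b (a + d + 1) a (a + d) hM (by omega) (by omega) θ'
        (fun e o g1 g2 g3 g4 he ho => hθ' e o (by omega) (by omega) (by omega) (by omega) he ho))
      (sep_of_rev s b (a + d + 1) (a + 1) (a + d + 1) hM (by omega) le_rfl θ
        (fun e o g1 g2 g3 g4 he ho => hθ e o (by omega) (by omega) (by omega) (by omega) he ho)))
    ⟨θP, fun e o g1 g2 g3 g4 he ho => rev_of_sep s b (a + d + 1) (a - 1) (a + d - 1) hM (by omega) (by omega)
      θP hθP e o (by omega) (by omega) (by omega) (by omega) he ho⟩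
  exact ⟨θ, sep_of_rev s b (a + d + 1) (a - 1) (a + d - 1) hM (by omega) (by omega) θ
      (fun e o g1 g2 g3 g4 he ho => h2 e o (by omega) (by omega) (by omega) (by omega) he ho),
    sep_of_rev s b (a + d + 1) a (a + d) hM (by omega) (by omega) θ
      (fun e o g1 g2 g3 g4 he ho => h1 e o (by omega) (by omega) (by omega) (by omega) he ho)⟩

/-- MIRROR CONTINUATION LAW `C′`, row `a` even, `s (a+d+1) < s (a+d)`: if the step at row `a` moves right, row
`a - 1` does not step. -/
theorem preceded_step_even_right (s b : ℕ → ℝ) (a d : ℕ) (ha : Even a) (hd : Odd d) (ha1 : 1 ≤ a)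
    (hfar : s (a + d + 1) < s (a + d))
    (hA : ∃ θ : ℝ, ∀ e o : ℕ, a ≤ e → e ≤ a + d → a ≤ o → o ≤ a + d → Even e → Odd o →
      b o + s o * θ < b e + s e * θ)
    (hB : ∃ θ : ℝ, ∀ e o : ℕ, a + 1 ≤ e → e ≤ a + d + 1 → a + 1 ≤ o → o ≤ a + d + 1 → Even e → Odd o →
      b o + s o * θ < b e + s e * θ)
    (hAB : ∀ θ : ℝ, ¬ ((∀ e o : ℕ, a ≤ e → e ≤ a + d → a ≤ o → o ≤ a + d → Even e → Odd o →
      b o + s o * θ < b e + s e * θ) ∧ (∀ e o : ℕ, a + 1 ≤ e → e ≤ a + d + 1 → a + 1 ≤ o → o ≤ a + d + 1 →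
      Even e → Odd o → b o + s o * θ < b e + s e * θ)))
    (hord : ∀ θ θ' : ℝ, (∀ e o : ℕ, a ≤ e → e ≤ a + d → a ≤ o → o ≤ a + d → Even e → Odd o →
      b o + s o * θ < b e + s e * θ) → (∀ e o : ℕ, a + 1 ≤ e → e ≤ a + d + 1 → a + 1 ≤ o → o ≤ a + d + 1 →
      Even e → Odd o → b o + s o * θ' < b e + s e * θ') → θ < θ')
    (hP : ∃ θ : ℝ, ∀ e o : ℕ, a - 1 ≤ e → e ≤ a + d - 1 → a - 1 ≤ o → o ≤ a + d - 1 → Even e → Odd o →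
      b o + s o * θ < b e + s e * θ) :
    ∃ θ : ℝ, (∀ e o : ℕ, a - 1 ≤ e → e ≤ a + d - 1 → a - 1 ≤ o → o ≤ a + d - 1 → Even e → Odd o →
      b o + s o * θ < b e + s e * θ) ∧ (∀ e o : ℕ, a ≤ e → e ≤ a + d → a ≤ o → o ≤ a + d → Even e → Odd o →
      b o + s o * θ < b e + s e * θ) := by
  obtain ⟨θA, hθA⟩ := hA
  obtain ⟨θB, hθB⟩ := hB
  obtain ⟨θP, hθP⟩ := hP
  have hM : Even (a + d + 1) := by
    obtain ⟨k, hk⟩ := ha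
    obtain ⟨l, hl⟩ := hd
    exact ⟨k + l + 1, by omega⟩
  have hd1 : 1 ≤ d := by
    obtain ⟨l, hl⟩ := hd
    omega
  obtain ⟨θ, h1, h2⟩ := away_step_terminal_even_mirror (fun t => s (a + d + 1 - t)) (fun t => b (a + d + 1 - t))
    0 d (⟨0, rfl⟩ : Even 0) hd (by simpa using hfar)
    ⟨θB, fun e o g1 g2 g3 g4 he ho => rev_of_sep s b (a + d + 1) (a + 1) (a + d + 1) hM (by omega) le_rfl θB
      hθB e o (by omega) (by omega) (by omega) (by omega) he ho⟩
    ⟨θA, fun e o g1 g2 g3 g4 he ho => rev_of_sep s b (a + d + 1) a (a + d) hM (by omega) (by omega) θA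
      hθA e o (by omega) (by omega) (by omega) (by omega) he ho⟩
    (fun θ hθ => hAB θ
      ⟨sep_of_rev s b (a + d + 1) a (a + d) hM (by omega) (by omega) θ
          (fun e o g1 g2 g3 g4 he ho => hθ.2 e o (by omega) (by omega) (by omega) (by omega) he ho),
       sep_of_rev s b (a + d + 1) (a + 1) (a + d + 1) hM (by omega) le_rfl θ
          (fun e o g1 g2 g3 g4 he ho => hθ.1 e o (by omega) (by omega) (by omega) (by omega) he ho)⟩)
    (fun θ θ' hθ hθ' => hord θ' θ
      (sep_of_rev s b (a + d + 1) a (a + d) hM (by omega) (by omega) θ'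
        (fun e o g1 g2 g3 g4 he ho => hθ' e o (by omega) (by omega) (by omega) (by omega) he ho))
      (sep_of_rev s b (a + d + 1) (a + 1) (a + d + 1) hM (by omega) le_rfl θ
        (fun e o g1 g2 g3 g4 he ho => hθ e o (by omega) (by omega) (by omega) (by omega) he ho)))
    ⟨θP, fun e o g1 g2 g3 g4 he ho => rev_of_sep s b (a + d + 1) (a - 1) (a + d - 1) hM (by omega) (by omega)
      θP hθP e o (by omega) (by omega) (by omega) (by omega) he ho⟩
  exact ⟨θ, sep_of_rev s b (a + d + 1) (a - 1) (a + d - 1) hM (by omega) (by omega) θ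
      (fun e o g1 g2 g3 g4 he ho => h2 e o (by omega) (by omega) (by omega) (by omega) he ho),
    sep_of_rev s b (a + d + 1) a (a + d) hM (by omega) (by omega) θ
      (fun e o g1 g2 g3 g4 he ho => h1 e o (by omega) (by omega) (by omega) (by omega) he ho)⟩

/-- MIRROR CONTINUATION LAW `C′`, row `a` odd, `s (a+d+1) < s (a+d)`: if the step at row `a` moves left, row
`a - 1` does not step. -/
theorem preceded_step_odd_left (s b : ℕ → ℝ) (a d : ℕ) (ha : Odd a) (hd : Odd d)
    (hfar : s (a + d + 1) < s (a + d))
    (hA : ∃ θ : ℝ, ∀ e o : ℕ, a ≤ e → e ≤ a + d → a ≤ o → o ≤ a + d → Even e → Odd o →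
      b o + s o * θ < b e + s e * θ)
    (hB : ∃ θ : ℝ, ∀ e o : ℕ, a + 1 ≤ e → e ≤ a + d + 1 → a + 1 ≤ o → o ≤ a + d + 1 → Even e → Odd o →
      b o + s o * θ < b e + s e * θ)
    (hAB : ∀ θ : ℝ, ¬ ((∀ e o : ℕ, a ≤ e → e ≤ a + d → a ≤ o → o ≤ a + d → Even e → Odd o →
      b o + s o * θ < b e + s e * θ) ∧ (∀ e o : ℕ, a + 1 ≤ e → e ≤ a + d + 1 → a + 1 ≤ o → o ≤ a + d + 1 →
      Even e → Odd o → b o + s o * θ < b e + s e * θ)))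
    (hord : ∀ θ θ' : ℝ, (∀ e o : ℕ, a ≤ e → e ≤ a + d → a ≤ o → o ≤ a + d → Even e → Odd o →
      b o + s o * θ < b e + s e * θ) → (∀ e o : ℕ, a + 1 ≤ e → e ≤ a + d + 1 → a + 1 ≤ o → o ≤ a + d + 1 →
      Even e → Odd o → b o + s o * θ' < b e + s e * θ') → θ' < θ)
    (hP : ∃ θ : ℝ, ∀ e o : ℕ, a - 1 ≤ e → e ≤ a + d - 1 → a - 1 ≤ o → o ≤ a + d - 1 → Even e → Odd o →
      b o + s o * θ < b e + s e * θ) :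
    ∃ θ : ℝ, (∀ e o : ℕ, a - 1 ≤ e → e ≤ a + d - 1 → a - 1 ≤ o → o ≤ a + d - 1 → Even e → Odd o →
      b o + s o * θ < b e + s e * θ) ∧ (∀ e o : ℕ, a ≤ e → e ≤ a + d → a ≤ o → o ≤ a + d → Even e → Odd o →
      b o + s o * θ < b e + s e * θ) := by
  obtain ⟨θA, hθA⟩ := hA
  obtain ⟨θB, hθB⟩ := hB
  obtain ⟨θP, hθP⟩ := hP
  have hM : Odd (a + d + 1) := by
    obtain ⟨k, hk⟩ := ha
    obtain ⟨l, hl⟩ := hd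
    exact ⟨k + l + 1, by omega⟩
  have ha1 : 1 ≤ a := by
    obtain ⟨k, hk⟩ := ha
    omega
  have hd1 : 1 ≤ d := by
    obtain ⟨l, hl⟩ := hd
    omega
  -- reversed and negated lines `S'_t = -S_{a+d+1-t}`; rows `a`, `a - 1` become rows `0`, `1`
  obtain ⟨θ, h1, h2⟩ := away_step_terminal_even (fun t => -s (a + d + 1 - t)) (fun t => -b (a + d + 1 - t)) 0 d
    (⟨0, rfl⟩ : Even 0) hd (by simpa using hfar)
    ⟨θB, fun e o g1 g2 g3 g4 he ho => negrev_of_sep s b (a + d + 1) (a + 1) (a + d + 1) hM (by omega) le_rfl θB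
      hθB e o (by omega) (by omega) (by omega) (by omega) he ho⟩
    ⟨θA, fun e o g1 g2 g3 g4 he ho => negrev_of_sep s b (a + d + 1) a (a + d) hM (by omega) (by omega) θA
      hθA e o (by omega) (by omega) (by omega) (by omega) he ho⟩
    (fun θ hθ => hAB θ
      ⟨sep_of_negrev s b (a + d + 1) a (a + d) hM (by omega) (by omega) θ
          (fun e o g1 g2 g3 g4 he ho => hθ.2 e o (by omega) (by omega) (by omega) (by omega) he ho),
       sep_of_negrev s b (a + d + 1) (a + 1) (a + d + 1) hM (by omega) le_rfl θ
          (fun e o g1 g2 g3 g4 he ho => hθ.1 e o (by omega) (by omega) (by omega) (by omega) he ho)⟩)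
    (fun θ θ' hθ hθ' => hord θ' θ
      (sep_of_negrev s b (a + d + 1) a (a + d) hM (by omega) (by omega) θ'
        (fun e o g1 g2 g3 g4 he ho => hθ' e o (by omega) (by omega) (by omega) (by omega) he ho))
      (sep_of_negrev s b (a + d + 1) (a + 1) (a + d + 1) hM (by omega) le_rfl θ
        (fun e o g1 g2 g3 g4 he ho => hθ e o (by omega) (by omega) (by omega) (by omega) he ho)))
    ⟨θP, fun e o g1 g2 g3 g4 he ho => negrev_of_sep s b (a + d + 1) (a - 1) (a + d - 1) hM (by omega) (by omega)
      θP hθP e o (by omega) (by omega) (by omega) (by omega) he ho⟩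
  exact ⟨θ, sep_of_negrev s b (a + d + 1) (a - 1) (a + d - 1) hM (by omega) (by omega) θ
      (fun e o g1 g2 g3 g4 he ho => h2 e o (by omega) (by omega) (by omega) (by omega) he ho),
    sep_of_negrev s b (a + d + 1) a (a + d) hM (by omega) (by omega) θ
      (fun e o g1 g2 g3 g4 he ho => h1 e o (by omega) (by omega) (by omega) (by omega) he ho)⟩

/-- MIRROR CONTINUATION LAW `C′`, row `a` odd, `s (a+d) < s (a+d+1)`: if the step at row `a` moves right, row
`a - 1` does not step. -/
theorem preceded_step_odd_right (s b : ℕ → ℝ) (a d : ℕ) (ha : Odd a) (hd : Odd d)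
    (hfar : s (a + d) < s (a + d + 1))
    (hA : ∃ θ : ℝ, ∀ e o : ℕ, a ≤ e → e ≤ a + d → a ≤ o → o ≤ a + d → Even e → Odd o →
      b o + s o * θ < b e + s e * θ)
    (hB : ∃ θ : ℝ, ∀ e o : ℕ, a + 1 ≤ e → e ≤ a + d + 1 → a + 1 ≤ o → o ≤ a + d + 1 → Even e → Odd o →
      b o + s o * θ < b e + s e * θ)
    (hAB : ∀ θ : ℝ, ¬ ((∀ e o : ℕ, a ≤ e → e ≤ a + d → a ≤ o → o ≤ a + d → Even e → Odd o →
      b o + s o * θ < b e + s e * θ) ∧ (∀ e o : ℕ, a + 1 ≤ e → e ≤ a + d + 1 → a + 1 ≤ o → o ≤ a + d + 1 →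
      Even e → Odd o → b o + s o * θ < b e + s e * θ)))
    (hord : ∀ θ θ' : ℝ, (∀ e o : ℕ, a ≤ e → e ≤ a + d → a ≤ o → o ≤ a + d → Even e → Odd o →
      b o + s o * θ < b e + s e * θ) → (∀ e o : ℕ, a + 1 ≤ e → e ≤ a + d + 1 → a + 1 ≤ o → o ≤ a + d + 1 →
      Even e → Odd o → b o + s o * θ' < b e + s e * θ') → θ < θ')
    (hP : ∃ θ : ℝ, ∀ e o : ℕ, a - 1 ≤ e → e ≤ a + d - 1 → a - 1 ≤ o → o ≤ a + d - 1 → Even e → Odd o →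
      b o + s o * θ < b e + s e * θ) :
    ∃ θ : ℝ, (∀ e o : ℕ, a - 1 ≤ e → e ≤ a + d - 1 → a - 1 ≤ o → o ≤ a + d - 1 → Even e → Odd o →
      b o + s o * θ < b e + s e * θ) ∧ (∀ e o : ℕ, a ≤ e → e ≤ a + d → a ≤ o → o ≤ a + d → Even e → Odd o →
      b o + s o * θ < b e + s e * θ) := by
  obtain ⟨θA, hθA⟩ := hA
  obtain ⟨θB, hθB⟩ := hB
  obtain ⟨θP, hθP⟩ := hP
  have hM : Odd (a + d + 1) := by
    obtain ⟨k, hk⟩ := ha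
    obtain ⟨l, hl⟩ := hd
    exact ⟨k + l + 1, by omega⟩
  have ha1 : 1 ≤ a := by
    obtain ⟨k, hk⟩ := ha
    omega
  have hd1 : 1 ≤ d := by
    obtain ⟨l, hl⟩ := hd
    omega
  obtain ⟨θ, h1, h2⟩ := away_step_terminal_even_mirror (fun t => -s (a + d + 1 - t))
    (fun t => -b (a + d + 1 - t)) 0 d (⟨0, rfl⟩ : Even 0) hd (by simpa using hfar)
    ⟨θB, fun e o g1 g2 g3 g4 he ho => negrev_of_sep s b (a + d + 1) (a + 1) (a + d + 1) hM (by omega) le_rfl θB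
      hθB e o (by omega) (by omega) (by omega) (by omega) he ho⟩
    ⟨θA, fun e o g1 g2 g3 g4 he ho => negrev_of_sep s b (a + d + 1) a (a + d) hM (by omega) (by omega) θA
      hθA e o (by omega) (by omega) (by omega) (by omega) he ho⟩
    (fun θ hθ => hAB θ
      ⟨sep_of_negrev s b (a + d + 1) a (a + d) hM (by omega) (by omega) θ
          (fun e o g1 g2 g3 g4 he ho => hθ.2 e o (by omega) (by omega) (by omega) (by omega) he ho),
       sep_of_negrev s b (a + d + 1) (a + 1) (a + d + 1) hM (by omega) le_rfl θ
          (fun e o g1 g2 g3 g4 he ho => hθ.1 e o (by omega) (by omega) (by omega) (by omega) he ho)⟩)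
    (fun θ θ' hθ hθ' => hord θ' θ
      (sep_of_negrev s b (a + d + 1) a (a + d) hM (by omega) (by omega) θ'
        (fun e o g1 g2 g3 g4 he ho => hθ' e o (by omega) (by omega) (by omega) (by omega) he ho))
      (sep_of_negrev s b (a + d + 1) (a + 1) (a + d + 1) hM (by omega) le_rfl θ
        (fun e o g1 g2 g3 g4 he ho => hθ e o (by omega) (by omega) (by omega) (by omega) he ho)))
    ⟨θP, fun e o g1 g2 g3 g4 he ho => negrev_of_sep s b (a + d + 1) (a - 1) (a + d - 1) hM (by omega) (by omega)
      θP hθP e o (by omega) (by omega) (by omega) (by omega) he ho⟩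
  exact ⟨θ, sep_of_negrev s b (a + d + 1) (a - 1) (a + d - 1) hM (by omega) (by omega) θ
      (fun e o g1 g2 g3 g4 he ho => h2 e o (by omega) (by omega) (by omega) (by omega) he ho),
    sep_of_negrev s b (a + d + 1) a (a + d) hM (by omega) (by omega) θ
      (fun e o g1 g2 g3 g4 he ho => h1 e o (by omega) (by omega) (by omega) (by omega) he ho)⟩

end Summit.ValiantsHypothesis.ValiantsHypothesis.Theorems.KPlusLogSqLawStepPreceded
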